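import Summits.ABC.StewartYu.GenThreeStepArchW
import Summits.ABC.StewartYu.GenThreeBaseArchW
import Summits.ABC.StewartYu.GenThreeReduceArchW
import Summits.ABC.StewartYu.GenThreeFrameSpecTwoRat
import Summits.ABC.StewartYu.GenThreeEndExits
import HarnessLib

/-!
# Cell abc-stewartyu, WP-L.A shell (parcel P-A1): the archimedean FRAME SPEC in the pivot-weighted currency —
# the per-rank dichotomy `DichotomyArchW` from «frame output at real points + record obligations», typed and proved

`Summits/ABC/StewartYu/GenThreeFrameSpecArchW.lean` — cell `abc-stewartyu` (HOME `run/shared/lean/pub/abc-stewartyu/`),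
route `YuMatveevShapeRat` (rung A1.L, crux r2 `ArchCoreRat`, stmt-ABC-20502), seat p4 (g9), parcel WP-L.A P-A1; the
archimedean twin of `GenThreeFrameSpecTwoRat.lean` (p3) / `GenThreeFrameSpecOdd.lean` (p4-g3).  Two plain
`Prop`-valued definitions (the record's and the frame's deliverables) and theorems.

WHAT THE FRAME OWES (`FrameArchW C Y n`): for every REDUCED rank-`n` datum of the pivot-weighted internal statement
`GenThreeInductionArchW.CoreArchW` — positive independent rationals `aⱼ`, `h(aⱼ) ≤ Aⱼ`, `1 ≤ Aⱼ`, ALL `bⱼ ≠ 0`,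
`gcd b = 1`, weights sorted (`Monotone A`), pivot `k₀` at a maximal weight, `|bⱼ|Aⱼ ≤ B·A_{k₀}` — under the
NEGATED BOUND `log|Λ| < −C(n)·Ω·log(eB)` ((2.14), the small value) and in the NON-TRIVIAL REGIME
`C(n)·Ω·log(eB) < ∑ Aⱼ|bⱼ| + log 2` ((2.6); the reductions are `GenThreeReduceArchW`): independent
complex units `ξ` (the frame's choice: `ξⱼ = αⱼ` or `αⱼ^{1/N}` via `GenThreeEndReal.rpowUnit`), a pivot `j₀`
(`b j₀ ≠ 0`) and zero-estimate letters `(D₀, S₀, X, D)` with the `ξ`-form frame output `FrameOutputReal` (p3's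
predicate: a nonzero Laurent polynomial whose `𝔚`-derivatives of order `≤ (n+1)S₀` vanish at `(x, ξˣ)`,
`|x| ≤ (n+1)X`) AND the record obligations `RecordArchW C Y n A D₀ S₀ X D`: exit A and full rank refuted (as in
`RecordOdd/RecordTwo`), and in exit C with `0 < r < n` the COVOLUME CLAUSE `P(κ)·Y r ≤ Ω`
(`P(κ) = (r!)²nʳ·|det M_κ|·∏A_κ`, every non-singular injective minor `κ`) together with the purely numeric
`0 < Y r`, `r(n+1) ≤ Y r·C n`, `2·C r + Y r ≤ Y r·C n` — NO logarithmic (5.22) line (lit SPEC §17: the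
archimedean cost line is closed inside `GenThreeStepArchW.stepArchW_of_exitC` from the regime).

`dichotomyArchW_of_frame`: zero estimate (`Nesterenko2003_prop51`, the tree theorem `Nesterenko2003_prop51_holds`,
taken by name as a hypothesis like every frame file) + frame ⇒ `DichotomyArchW C n`;
`archCoreRat_of_frameW_two_le(_pow)`: the crux text from the frame at ranks `≥ 2`, `2 ≤ C 1`.

WHAT THIS IS NOT: no analytic content; no crux moves.

References: Yu. V. Nesterenko, LNM 1819 (2003), §5.1 (5.3)–(5.4), §5.2 Lemmas 5.2–5.4, (5.21)–(5.22)
(pp. 96–106); E. M. Matveev, Izv. Math. 64 (2000), (1.3).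
-/

noncomputable section

open Finset
open Literature.NumberTheory.Transcendental
open Literature.NumberTheory.Transcendental.GaGm

namespace Summit.ABC.StewartYu.GenThreeFrameSpecArchW

open Summit.ABC.StewartYu.GenThreeInductionArch
open Summit.ABC.StewartYu.GenThreeInductionArchW
open Summit.ABC.StewartYu.GenThreeStepArchW (stepArchW_of_exitC)
open Summit.ABC.StewartYu.GenThreeBaseArchW
open Summit.ABC.StewartYu.GenThreeReduceArchW (dichotomyArchW_of_reduced)
open Summit.ABC.StewartYu.GenThreeFrameSpecTwo (bHyperplane mem_bHyperplane FrameOutputTwo)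
open Summit.ABC.StewartYu.GenThreeFrameSpecTwoRat (FrameOutputReal)
open Summit.ABC.StewartYu.GenThreeEndExits (span_rat_of_exitC pos_of_exitC)

variable {n : ℕ}

/-! ### The record's deliverable, archimedean, pivot-weighted currency -/

/-- **RECORD OBLIGATIONS at rank `n`, archimedean frame** for the letters `(D₀, S₀, X, D)`, the weights `A`, the
constant function `C` and the slack function `Y`: (A) exit A of the zero estimate is numerically impossible; (B) exit
B/C with a character lattice of full rank `r = n` is impossible; (C) for `0 < r < n`, the exit-C inequality implies
the COVOLUME CLAUSE `(r!)²nʳ·|det M_κ|·∏A_κ·Y r ≤ ∏A` for every injective non-singular minor `κ`; (N) the numeric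
clauses `0 < Y r`, `r(n+1) ≤ Y r·C n`, `2·C r + Y r ≤ Y r·C n` for `0 < r < n`.
[cite: Nesterenko2003, §5.2 (5.14)–(5.17), Lemma 5.4, (5.21)–(5.22) (pp. 99–106)] -/
def RecordArchW (C : ℕ → ℝ) (Y : ℕ → ℝ) (n : ℕ) (A : Fin n → ℝ) (D₀ S₀ X : ℕ) (D : Fin n → ℕ) : Prop :=
  (∀ (r d₀ : ℕ) (M : Matrix (Fin r) (Fin n) ℤ), r ≤ n → d₀ ≤ 1 →
      LinearIndependent ℤ (fun i => M i) →
      ¬ (Nat.choose (S₀ + (r + 1 - d₀)) (r + 1 - d₀) * (2 * X + 1) * nesterenkoH n r d₀ M D₀ D ≤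
          (n + 1).factorial * 2 ^ n * D₀ * ∏ j, D j)) ∧
  (∀ (d₀ : ℕ) (M : Matrix (Fin n) (Fin n) ℤ), d₀ ≤ 1 → LinearIndependent ℤ (fun i => M i) →
      ¬ (Nat.choose (S₀ + (n - d₀)) (n - d₀) * (2 * X + 1) * nesterenkoH n n d₀ M D₀ D ≤
          (n + 1).factorial * 2 ^ n * D₀ * ∏ j, D j)) ∧
  (∀ (r d₀ : ℕ) (M : Matrix (Fin r) (Fin n) ℤ), 0 < r → r < n → d₀ ≤ 1 →
      LinearIndependent ℤ (fun i => M i) →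
      Nat.choose (S₀ + (r - d₀)) (r - d₀) * (2 * X + 1) * nesterenkoH n r d₀ M D₀ D ≤
          (n + 1).factorial * 2 ^ n * D₀ * ∏ j, D j →
      ∀ κ : Fin r → Fin n, Function.Injective κ →
        (Matrix.of fun i j => (M j (κ i) : ℝ)).det ≠ 0 →
        ((r.factorial : ℝ)) ^ 2 * (n : ℝ) ^ r *
            (|(Matrix.of fun i j => (M j (κ i) : ℝ)).det| * ∏ i, A (κ i)) * Y r ≤ ∏ j, A j) ∧
  (∀ r : ℕ, 0 < r → r < n → 0 < Y r ∧ (r : ℝ) * (n + 1) ≤ Y r * C n ∧ 2 * C r + Y r ≤ Y r * C n)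

/-- **THE ARCHIMEDEAN FRAME at rank `n`** (what the r2 line owes, per rank): for every REDUCED rank-`n` datum of
`CoreArchW` in the non-trivial regime, independent complex units `ξ`, a pivot `b j₀ ≠ 0` and letters with the
`ξ`-form frame output and the record obligations. [cite: Nesterenko2003, §5; shape only] -/
def FrameArchW (C : ℕ → ℝ) (Y : ℕ → ℝ) (n : ℕ) : Prop :=
  ∀ (a : Fin n → ℚ) (b : Fin n → ℤ) (A : Fin n → ℝ) (B : ℝ) (k₀ : Fin n),
    (∀ j, 0 < a j) →
    (∀ μ : Fin n → ℤ, ∏ j, a j ^ μ j = 1 → μ = 0) →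
    (∀ j, Height.logHeight₁ (a j) ≤ A j) → (∀ j, 1 ≤ A j) →
    (∀ j, b j ≠ 0) → Finset.univ.gcd b = 1 → Monotone A → (∀ j, A j ≤ A k₀) →
    (∀ j, (|b j| : ℝ) * A j ≤ B * A k₀) →
    ¬ -(C n * (∏ j, A j) * Real.log (Real.exp 1 * B)) ≤
        Real.log |∑ j, (b j : ℝ) * Real.log (a j : ℝ)| →
    C n * (∏ j, A j) * Real.log (Real.exp 1 * B) < ∑ j, A j * |(b j : ℝ)| + Real.log 2 →
    ∃ (ξ : Fin n → ℂˣ) (j₀ : Fin n) (D₀ S₀ X : ℕ) (D : Fin n → ℕ),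
      (∀ φ : Fin n → ℤ, ∏ j, ξ j ^ φ j = 1 → φ = 0) ∧ b j₀ ≠ 0 ∧
      FrameOutputReal n ξ b j₀ D₀ S₀ X D ∧ RecordArchW C Y n A D₀ S₀ X D

/-- **Rational points are the case `ξⱼ = αⱼ`**: the landed place-free frame output `FrameOutputTwo n α b …`
(identities at `(x, αˣ)`, as emitted by lp-1's `ArchLvInv.frameOutputTwo` and by the M3 frames) IS
`FrameOutputReal n ξ b …` at the units `ξⱼ = αⱼ`. [cite: Nesterenko2003, §5.1 (5.3)–(5.4)] -/
theorem frameOutputReal_of_frameOutputTwo (a : Fin n → ℚ) (ha : ∀ j, a j ≠ 0) (b : Fin n → ℤ) (j₀ : Fin n)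
    (D₀ S₀ X : ℕ) (D : Fin n → ℕ) (h : FrameOutputTwo n a b j₀ D₀ S₀ X D) :
    FrameOutputReal n (fun j => Units.mk0 ((a j : ℂ)) (by exact_mod_cast ha j)) b j₀ D₀ S₀ X D := by
  obtain ⟨I, q, i₀, h1, h2, h3, h4, h5⟩ := h
  exact ⟨I, q, i₀, h1, h2, h3, h4, fun x hx t ν hν hT => by
    simpa only [Units.val_mk0] using h5 x hx t ν hν hT⟩

/-- **THE ARCHIMEDEAN FRAME at rank `n`, RATIONAL-POINT form** (frame output at the points `(x, αˣ)`, the shape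
lp-1's `ArchLvInv.frameOutputTwo` delivers): as `FrameArchW` with `FrameOutputTwo n a b j₀ …` in place of the
`ξ`-form. [cite: Nesterenko2003, §5; shape only] -/
def FrameArchWRat (C : ℕ → ℝ) (Y : ℕ → ℝ) (n : ℕ) : Prop :=
  ∀ (a : Fin n → ℚ) (b : Fin n → ℤ) (A : Fin n → ℝ) (B : ℝ) (k₀ : Fin n),
    (∀ j, 0 < a j) →
    (∀ μ : Fin n → ℤ, ∏ j, a j ^ μ j = 1 → μ = 0) →
    (∀ j, Height.logHeight₁ (a j) ≤ A j) → (∀ j, 1 ≤ A j) →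
    (∀ j, b j ≠ 0) → Finset.univ.gcd b = 1 → Monotone A → (∀ j, A j ≤ A k₀) →
    (∀ j, (|b j| : ℝ) * A j ≤ B * A k₀) →
    ¬ -(C n * (∏ j, A j) * Real.log (Real.exp 1 * B)) ≤
        Real.log |∑ j, (b j : ℝ) * Real.log (a j : ℝ)| →
    C n * (∏ j, A j) * Real.log (Real.exp 1 * B) < ∑ j, A j * |(b j : ℝ)| + Real.log 2 →
    ∃ (j₀ : Fin n) (D₀ S₀ X : ℕ) (D : Fin n → ℕ), b j₀ ≠ 0 ∧
      FrameOutputTwo n a b j₀ D₀ S₀ X D ∧ RecordArchW C Y n A D₀ S₀ X D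

/-- The rational-point frame is a `ξ`-form frame (`ξⱼ := αⱼ`, independence transported by
`GenThreeVanishing.hind_units_of_rat`). [folklore] -/
theorem frameArchW_of_frameArchWRat {C Y : ℕ → ℝ} (hF : FrameArchWRat C Y n) : FrameArchW C Y n := by
  intro a b A B k₀ ha hind hA hA1 hbz hgcd hmono hmax hBw hneg hreg
  obtain ⟨j₀, D₀, S₀, X, D, hbj₀, hout, hrec⟩ := hF a b A B k₀ ha hind hA hA1 hbz hgcd hmono hmax hBw hneg hreg
  have ha0 : ∀ j, a j ≠ 0 := fun j => (ha j).ne'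
  exact ⟨fun j => Units.mk0 ((a j : ℂ)) (by exact_mod_cast ha0 j), j₀, D₀, S₀, X, D,
    GenThreeVanishing.hind_units_of_rat a ha0 hind, hbj₀, frameOutputReal_of_frameOutputTwo a ha0 b j₀ D₀ S₀ X D hout,
    hrec⟩

/-! ### Composition -/

/-- **The pivot-weighted dichotomy from the frame.**  Reductions (`dichotomyArchW_of_reduced`); zero estimate +
frame output ⇒ the END with exits for independent units (`GenThreeEndReal.exists_exits_units` on
`𝔚 = bHyperplane b`); exit A and full rank are refuted by the record; exit C with `0 < r < n` is the
pivot-weighted Matveev step (`stepArchW_of_exitC`) closed by the regime and the record's covolume/numeric clauses.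
[cite: Nesterenko2003, §5.2] -/
theorem dichotomyArchW_of_frame (hZ : Nesterenko2003_prop51) {C Y : ℕ → ℝ} (hC0 : ∀ r, 0 ≤ C r)
    (hCmono : ∀ r, r < n → C r ≤ C n) (hF : FrameArchW C Y n) : DichotomyArchW C n := by
  classical
  refine dichotomyArchW_of_reduced (hC0 n) hCmono ?_
  intro a b A B k₀ ha hind hA hA1 hbz hgcd hmono hmax hBw hneg hreg
  obtain ⟨ξ, j₀, D₀, S₀, X, D, hindξ, hbj₀, hout, hrecA, hrecB, hrecC, hrecN⟩ :=
    hF a b A B k₀ ha hind hA hA1 hbz hgcd hmono hmax hBw hneg hreg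
  obtain ⟨I, q, i₀, ha', hκ, hi₀, hq, hL⟩ := hout
  have hinj : Set.InjOn (fun i : ℕ × (Fin n → ℤ) => (i.1, i.2)) (I : Set (ℕ × (Fin n → ℤ))) := by
    intro x _ y _ h
    exact Prod.ext (congrArg Prod.fst h) (congrArg Prod.snd h)
  obtain ⟨H, r, M, hrn, hd, hM, hchars, hexits⟩ :=
    GenThreeEndReal.exists_exits_units hZ ξ hindξ b j₀ hbj₀ (bHyperplane b) (mem_bHyperplane b) I
      Prod.fst Prod.snd q D₀ S₀ X D ha' hκ hinj hi₀ hq hL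
  have hb : b ≠ 0 := fun h0 => hbj₀ (by rw [h0]; rfl)
  rcases hexits with ⟨_hnex, hineqA⟩ | ⟨hex, hineqC⟩
  · exact absurd hineqA (hrecA r H.addDim M hrn hd hM)
  · rcases Nat.lt_or_ge r n with hlt | hge
    · have hr0 : 0 < r := pos_of_exitC b hb (fun i => M i) hex
      have hbM := span_rat_of_exitC b (fun i => M i) hex
      obtain ⟨hYpos, hYC1, hYC2⟩ := hrecN r hr0 hlt
      exact stepArchW_of_exitC hr0 hlt (hC0 r) a ha hind A hA hA1 b k₀ (hbz k₀) hBw H (fun i => M i) hM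
        hchars hbM hreg hYpos hYC1 hYC2 (hrecC r H.addDim M hr0 hlt hd hM hineqC)
    · have hrn' : r = n := le_antisymm hrn hge
      subst hrn'
      exact absurd hineqC (hrecB H.addDim M hd hM)

/-- The pivot-weighted dichotomy from the RATIONAL-POINT frame. [cite: Nesterenko2003, §5.2] -/
theorem dichotomyArchW_of_frameRat (hZ : Nesterenko2003_prop51) {C Y : ℕ → ℝ} (hC0 : ∀ r, 0 ≤ C r)
    (hCmono : ∀ r, r < n → C r ≤ C n) (hF : FrameArchWRat C Y n) : DichotomyArchW C n :=
  dichotomyArchW_of_frame hZ hC0 hCmono (frameArchW_of_frameArchWRat hF)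

/-- **END-TO-END: the crux text `ArchCoreRat` from the zero estimate, a monotone admissible `C ≤ c₁ⁿ` with
`2 ≤ C 1`, and the archimedean frame (with some slack function `Y`, per rank) at every rank `n ≥ 2`.**
[cite: Nesterenko2003, Thm 2.2 (p. 55); Matveev2000, Cor 2.3; shape only] -/
theorem archCoreRat_of_frameW_two_le {C : ℕ → ℝ} {c₁ : ℝ} (hC : ∀ m, 0 ≤ C m ∧ C m ≤ c₁ ^ m)
    (hCmono : Monotone C) (hC1 : 2 ≤ C 1)
    (hF : Nesterenko2003_prop51 → ∀ n, 2 ≤ n → ∃ Y : ℕ → ℝ, FrameArchW C Y n)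
    (hZ : Nesterenko2003_prop51) :
    ∃ c : ℝ, ∀ (r : ℕ) (a : Fin r → ℚ) (b : Fin r → ℤ) (A : Fin r → ℝ) (B : ℝ),
      (∀ i, 0 < a i) →
      (∀ μ : Fin r → ℤ, ∏ i, a i ^ μ i = 1 → μ = 0) →
      (∀ i, Height.logHeight₁ (a i) ≤ A i) → (∀ i, 1 ≤ A i) →
      b ≠ 0 → (∀ i, (|b i| : ℝ) ≤ B) →
      -(c ^ r * (∏ i, A i) * Real.log (Real.exp 1 * B)) ≤
        Real.log |∑ i, (b i : ℝ) * Real.log (a i : ℝ)| :=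
  archCoreRat_of_dichotomyW_two_le hC hCmono hC1 fun n hn => by
    obtain ⟨Y, hFY⟩ := hF hZ n hn
    exact dichotomyArchW_of_frame hZ (fun r => (hC r).1) (fun _ hr => hCmono hr.le) hFY

/-- **The same with `C r := cʳ`, `2 ≤ c`** — the registered shape of the r2 line: the archimedean frame owes
`Nesterenko2003_prop51 → ∀ n ≥ 2, ∃ Y, FrameArchW (fun r => c ^ r) Y n` for ONE real `c ≥ 2` (the slack
function `Y` may depend on the rank `n`); the zero estimate is the tree theorem `Nesterenko2003_prop51_holds`.
[cite: Nesterenko2003, Thm 2.2 (p. 55); shape only] -/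
theorem archCoreRat_of_frameW_two_le_pow {c : ℝ} (hc : 2 ≤ c)
    (hF : Nesterenko2003_prop51 → ∀ n, 2 ≤ n → ∃ Y : ℕ → ℝ, FrameArchW (fun r => c ^ r) Y n)
    (hZ : Nesterenko2003_prop51) :
    ∃ c : ℝ, ∀ (r : ℕ) (a : Fin r → ℚ) (b : Fin r → ℤ) (A : Fin r → ℝ) (B : ℝ),
      (∀ i, 0 < a i) →
      (∀ μ : Fin r → ℤ, ∏ i, a i ^ μ i = 1 → μ = 0) →
      (∀ i, Height.logHeight₁ (a i) ≤ A i) → (∀ i, 1 ≤ A i) →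
      b ≠ 0 → (∀ i, (|b i| : ℝ) ≤ B) →
      -(c ^ r * (∏ i, A i) * Real.log (Real.exp 1 * B)) ≤
        Real.log |∑ i, (b i : ℝ) * Real.log (a i : ℝ)| := by
  have hc1 : 1 ≤ c := by linarith
  exact archCoreRat_of_frameW_two_le (c₁ := c) (fun m => ⟨by positivity, le_rfl⟩)
    (fun r s hrs => pow_le_pow_right₀ hc1 hrs) (by simpa using hc) hF hZ

end Summit.ABC.StewartYu.GenThreeFrameSpecArchW

end
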